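import Summits.ValiantsHypothesis.ValiantsHypothesis.Theorems.RigidityForcesSymmetryGrenetFirstOrderRankRigidFinalModuloOverlap
import Summits.ValiantsHypothesis.ValiantsHypothesis.Theorems.RigidityForcesSymmetryGrenetFirstOrderRankRigidBlockIgt

/-!
# Route RigidityForcesSymmetry — `GrenetFirstOrderRankRigid` (item stmt-ValiantsHypothesis-21029),
line `grenet_gauge`: stub `stub_linearRigid` — the final assembly modulo the blocks of type II

For the crux line `Cruxes/GrenetFirstOrderRankRigid/Lines/grenet_gauge.lean` (blueprint
`Lines/grenet_gauge-stub_linearRigid-PROOF.md`; interface `…-BLOCKS.md`).  This is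
`grenet_linearRigid_of_overlapBlocks` (`…FinalModuloOverlap`, val-width-21029-p2) with the type-I>
hypothesis `hIgt` DISCHARGED by `grenet_overlap_PQ` (`…BlockIgt`, val-width-21029-p3), and with the three
remaining hypotheses of type II — `hII` ((D-PQ) for the pairs `T ⊊ U`), `hTu` (genuine tail entries of
a pair `(univ, T)` in one column agree), `hH0` (genuine head entries of a pair `(S, ∅)` in one row agree)
— each granted, besides the homogeneous tangency, the SUPPORT CONDITION of the direction (its entries
vanish off the tail/head positions, `grenet_allowed_entry`): the overlap blocks need it (for an overlap
of width one the column weights alone do not single out the tail and head shapes), and the assembly has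
it (`rankConstraint_sub_gauge`).

Main statement: `grenet_linearRigid_of_blockII`.  Once `hII`, `hTu`, `hH0` are theorems the line's stub
is `exact grenet_linearRigid_of_blockII (enumSubsets n) … Λ' A' htr hC h3`.  No new definitions.
VP ≠ VNP is not moved by this file.
-/

noncomputable section

open MvPolynomial Matrix Finset

namespace Summit.ValiantsHypothesis.Theorems.RigidityForcesSymmetry.GrenetGauge

open Literature.Computability.AlgebraicComplexity

variable {k : Type*} [CommRing k] [IsDomain k] {n N : ℕ} (e : Finset (Fin n) ≃ Fin (N + 1))

/-- **`stub_linearRigid` modulo the blocks of type II.**  For Grenet's pencil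
`Λ = coeff_0 (Grenet.repr k n e)`, `A_v = coeff_{x_v} (Grenet.repr k n e)` (any vertex enumeration `e`,
any integral domain `k`): if the three type-II block identities `hII`, `hTu`, `hH0` hold for every
homogeneous direction that is Zariski-tangent at the pencil and supported on the tail/head positions,
then every direction `(Λ', A')` that is Zariski-tangent (`tr(adj x̃ · x̃') = 0`), tangent to the rank
stratum (`A'_v (ker A_v) ⊆ im A_v`) and has a trace-balanced gauge constant part is a gauge direction.
(The gap blocks, the blocks `|U| = |T|`, W0 and the type-I> overlap blocks are theorems.)
[cite: Grenet2011, Thm. 1] -/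
theorem grenet_linearRigid_of_blockII (hn : n ≠ 0) (hN : 2 ^ n = N + 1)
    (hII : ∀ (A' : Fin n × Fin n → Matrix (Fin N) (Fin N) k),
      ((Grenet.repr k n e).adjugate * ∑ v, (X v : MvPolynomial (Fin n × Fin n) k) • (A' v).map C).trace = 0 →
      (∀ (w : Fin n × Fin n) (a b : Fin N), A' w a b ≠ 0 →
        (w.1 ∉ e.symm ((e univ).succAbove a) ∧ (w.2 : ℕ) = (e.symm ((e univ).succAbove a)).card) ∨
        (w.1 ∈ e.symm ((e ∅).succAbove b) ∧ (e.symm ((e ∅).succAbove b)).card = (w.2 : ℕ) + 1)) →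
      ∀ (i j : Fin N) (v : Fin n × Fin n) (i' j' : Fin N) (v' : Fin n × Fin n),
      (v.1 ∉ e.symm ((e univ).succAbove i) ∧ (v.2 : ℕ) = (e.symm ((e univ).succAbove i)).card) →
      ¬ (v.1 ∈ e.symm ((e ∅).succAbove j) ∧ (e.symm ((e ∅).succAbove j)).card = (v.2 : ℕ) + 1) →
      (v'.1 ∈ e.symm ((e ∅).succAbove j') ∧ (e.symm ((e ∅).succAbove j')).card = (v'.2 : ℕ) + 1) →
      ¬ (v'.1 ∉ e.symm ((e univ).succAbove i') ∧ (v'.2 : ℕ) = (e.symm ((e univ).succAbove i')).card) →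
      insert v.1 (e.symm ((e univ).succAbove i)) = e.symm ((e univ).succAbove i') →
      e.symm ((e ∅).succAbove j) = (e.symm ((e ∅).succAbove j')).erase v'.1 →
      e.symm ((e ∅).succAbove j) ⊆ e.symm ((e univ).succAbove i') →
      A' v' i' j' = -A' v i j)
    (hTu : ∀ (A' : Fin n × Fin n → Matrix (Fin N) (Fin N) k),
      ((Grenet.repr k n e).adjugate * ∑ v, (X v : MvPolynomial (Fin n × Fin n) k) • (A' v).map C).trace = 0 →
      (∀ (w : Fin n × Fin n) (a b : Fin N), A' w a b ≠ 0 →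
        (w.1 ∉ e.symm ((e univ).succAbove a) ∧ (w.2 : ℕ) = (e.symm ((e univ).succAbove a)).card) ∨
        (w.1 ∈ e.symm ((e ∅).succAbove b) ∧ (e.symm ((e ∅).succAbove b)).card = (w.2 : ℕ) + 1)) →
      ∀ (i j : Fin N) (v : Fin n × Fin n) (i' : Fin N) (v' : Fin n × Fin n),
      (v.1 ∉ e.symm ((e univ).succAbove i) ∧ (v.2 : ℕ) = (e.symm ((e univ).succAbove i)).card) →
      ¬ (v.1 ∈ e.symm ((e ∅).succAbove j) ∧ (e.symm ((e ∅).succAbove j)).card = (v.2 : ℕ) + 1) →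
      (v'.1 ∉ e.symm ((e univ).succAbove i') ∧ (v'.2 : ℕ) = (e.symm ((e univ).succAbove i')).card) →
      ¬ (v'.1 ∈ e.symm ((e ∅).succAbove j) ∧ (e.symm ((e ∅).succAbove j)).card = (v'.2 : ℕ) + 1) →
      insert v.1 (e.symm ((e univ).succAbove i)) = univ → insert v'.1 (e.symm ((e univ).succAbove i')) = univ →
      A' v i j = A' v' i' j)
    (hH0 : ∀ (A' : Fin n × Fin n → Matrix (Fin N) (Fin N) k),
      ((Grenet.repr k n e).adjugate * ∑ v, (X v : MvPolynomial (Fin n × Fin n) k) • (A' v).map C).trace = 0 →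
      (∀ (w : Fin n × Fin n) (a b : Fin N), A' w a b ≠ 0 →
        (w.1 ∉ e.symm ((e univ).succAbove a) ∧ (w.2 : ℕ) = (e.symm ((e univ).succAbove a)).card) ∨
        (w.1 ∈ e.symm ((e ∅).succAbove b) ∧ (e.symm ((e ∅).succAbove b)).card = (w.2 : ℕ) + 1)) →
      ∀ (i j : Fin N) (v : Fin n × Fin n) (j' : Fin N) (v' : Fin n × Fin n),
      (v.1 ∈ e.symm ((e ∅).succAbove j) ∧ (e.symm ((e ∅).succAbove j)).card = (v.2 : ℕ) + 1) →
      ¬ (v.1 ∉ e.symm ((e univ).succAbove i) ∧ (v.2 : ℕ) = (e.symm ((e univ).succAbove i)).card) →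
      (v'.1 ∈ e.symm ((e ∅).succAbove j') ∧ (e.symm ((e ∅).succAbove j')).card = (v'.2 : ℕ) + 1) →
      ¬ (v'.1 ∉ e.symm ((e univ).succAbove i) ∧ (v'.2 : ℕ) = (e.symm ((e univ).succAbove i)).card) →
      (e.symm ((e ∅).succAbove j)).erase v.1 = ∅ → (e.symm ((e ∅).succAbove j')).erase v'.1 = ∅ →
      A' v i j = A' v' i j')
    (Λ' : Matrix (Fin N) (Fin N) k) (A' : Fin n × Fin n → Matrix (Fin N) (Fin N) k)
    (htr : (((Matrix.of fun i j => coeff 0 (Grenet.repr k n e i j) : Matrix (Fin N) (Fin N) k).map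
        (C : k →+* MvPolynomial (Fin n × Fin n) k) +
        ∑ v, (X v : MvPolynomial (Fin n × Fin n) k) •
          (Matrix.of fun i j => coeff (Finsupp.single v 1) (Grenet.repr k n e i j) : Matrix (Fin N) (Fin N) k).map C).adjugate
        * (Λ'.map C + ∑ v, (X v : MvPolynomial (Fin n × Fin n) k) • (A' v).map C)).trace = 0)
    (hC : ∀ v w, (Matrix.of fun i j => coeff (Finsupp.single v 1) (Grenet.repr k n e i j) : Matrix (Fin N) (Fin N) k).mulVec w = 0 →
      ∃ u, (A' v).mulVec w = (Matrix.of fun i j => coeff (Finsupp.single v 1) (Grenet.repr k n e i j) : Matrix (Fin N) (Fin N) k).mulVec u)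
    (h3 : ∃ P Q : Matrix (Fin N) (Fin N) k, P.trace = Q.trace ∧
      Λ' = P * (Matrix.of fun i j => coeff 0 (Grenet.repr k n e i j) : Matrix (Fin N) (Fin N) k) - (Matrix.of fun i j => coeff 0 (Grenet.repr k n e i j) : Matrix (Fin N) (Fin N) k) * Q) :
    ∃ P Q : Matrix (Fin N) (Fin N) k,
      Λ' = P * (Matrix.of fun i j => coeff 0 (Grenet.repr k n e i j) : Matrix (Fin N) (Fin N) k) - (Matrix.of fun i j => coeff 0 (Grenet.repr k n e i j) : Matrix (Fin N) (Fin N) k) * Q ∧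
      ∀ v, A' v = P * (Matrix.of fun i j => coeff (Finsupp.single v 1) (Grenet.repr k n e i j) : Matrix (Fin N) (Fin N) k) -
        (Matrix.of fun i j => coeff (Finsupp.single v 1) (Grenet.repr k n e i j) : Matrix (Fin N) (Fin N) k) * Q := by
  -- the pencil of the coefficient matrices is Grenet's matrix
  have hpencil : ((Matrix.of fun i j => coeff 0 (Grenet.repr k n e i j) : Matrix (Fin N) (Fin N) k).map
        (C : k →+* MvPolynomial (Fin n × Fin n) k) +
        ∑ v, (X v : MvPolynomial (Fin n × Fin n) k) •
          (Matrix.of fun i j => coeff (Finsupp.single v 1) (Grenet.repr k n e i j) : Matrix (Fin N) (Fin N) k).map C)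
      = Grenet.repr k n e := grenet_pencil_eq n hn hN e
  refine linearRigid_of_homogeneous _ _ (fun A'' htr'' hC'' => ?_) Λ' A' htr hC h3
  rw [hpencil] at htr''
  -- the allowed entries
  have hsupp : ∀ v i j, A'' v i j ≠ 0 →
      (v.1 ∉ e.symm ((e univ).succAbove i) ∧ (v.2 : ℕ) = (e.symm ((e univ).succAbove i)).card) ∨
      (v.1 ∈ e.symm ((e ∅).succAbove j) ∧ (e.symm ((e ∅).succAbove j)).card = (v.2 : ℕ) + 1) :=
    fun v i j hne => grenet_allowed_entry k e (fun _ _ => rfl) (A'' v) (hC'' v) hne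
  -- the potential of the arc entries (block W0)
  obtain ⟨φ, -, -, hφ⟩ := grenet_arcEntries_eq_potential e hn hN A'' htr''
  refine grenet_hom_of_blocks e (fun _ _ => rfl) (fun _ _ _ => rfl) A'' hsupp ?_ ?_ ?_ ?_ ?_ ?_ φ
    (fun i j v ht hCj => hφ v i j ht.1 ht.2 hCj)
  · -- (PQ): by the relative size and position of the pair
    intro i j v i' j' v' ht hnh hh hnt hU hT
    rcases lt_trichotomy (e.symm ((e univ).succAbove i')).card (e.symm ((e ∅).succAbove j)).card with hlt | heq | hgt
    · exact grenet_gap_PQ e hn hN A'' htr'' ht hh hU hT hlt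
    · exact grenet_blockIeq_PQ e hn hN A'' htr'' i j v i' j' v' ht.1 ht.2 hnh hh.1 hh.2 hnt hU hT heq
    · by_cases hsub : e.symm ((e ∅).succAbove j) ⊆ e.symm ((e univ).succAbove i')
      · exact hII A'' htr'' hsupp i j v i' j' v' ht hnh hh hnt hU hT hsub
      · -- type I>: the overlap blocks (`grenet_overlap_PQ`)
        have hle : (e.symm ((e ∅).succAbove j)).card ≤ (e.symm ((e univ).succAbove i)).card := by
          have h1 : (e.symm ((e univ).succAbove i')).card = (e.symm ((e univ).succAbove i)).card + 1 := by
            rw [← hU, Finset.card_insert_of_notMem ht.1]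
          omega
        exact grenet_overlap_PQ e hn hN A'' htr'' hsupp ht hh hU hT hle hsub
  · exact hTu A'' htr'' hsupp
  · exact hH0 A'' htr'' hsupp
  · -- (Q0)
    intro i j v ht hnh hTu'
    refine grenet_gap_Q0 e hn hN A'' htr'' ht hTu' ?_
    have hcard : (insert v.1 (e.symm ((e univ).succAbove i))).card = (v.2 : ℕ) + 1 := by
      rw [Finset.card_insert_of_notMem ht.1, ht.2]
    have hne : insert v.1 (e.symm ((e univ).succAbove i)) ≠ univ := fun hU =>
      hnh ⟨by rw [hTu']; exact Finset.mem_univ _, by rw [hTu', ← hU, hcard]⟩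
    have := Finset.card_lt_card (Finset.ssubset_univ_iff.mpr hne)
    rwa [Finset.card_univ, Fintype.card_fin] at this
  · -- (P0)
    intro i j v hh hnt hS0
    refine grenet_gap_P0 e hn hN A'' htr'' hh hS0 fun hR0 => hnt ⟨?_, ?_⟩
    · rw [hS0]; exact Finset.notMem_empty _
    · have := Finset.card_erase_of_mem hh.1
      rw [hR0, Finset.card_empty, hh.2] at this
      rw [hS0, Finset.card_empty]; omega
  · -- (y)
    intro i j v i₃ j₃ v₃ i₄ j₄ v₄ ht hh ht3 hnh3 hU3 hT3 hh4 hnt4 hU4 hT4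
    exact grenet_blockIeq_y e hn hN A'' htr'' i j v ht.1 ht.2 hh.1 hh.2 i₃ j₃ v₃ ht3.1 ht3.2 hnh3 hU3 hT3
      i₄ j₄ v₄ hh4.1 hh4.2 hnt4 hU4 hT4

end Summit.ValiantsHypothesis.Theorems.RigidityForcesSymmetry.GrenetGauge
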